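import Summits.QuantumFields.YangMills.Theorems.BalabanUVNodesN19FinestStepSpecies
import Summits.QuantumFields.YangMills.Theorems.BalabanUVNodesN19ConstantsSpeciesRate

/-!
# BalabanUVNodes ∕ N19 (NE7 proper) — THE LEDGER ROAD (ii) WITH THE FRAME's ESTIMATE PIECE F3′ SUPPLIED BY THE SPECIES DATA: reassembly, the N19 edge,
# and the reading at the spine carriers with NO unprinted estimate among the ledger pieces

Cell `pub-ymgap` (HUMAN RULING D-0062, Track A), R134 ACCELERATION seat `pub-ymgap-dag-n19-d` (strategy s2 «by-name knit at the record»), gen 5, module 13 =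
this lineage's twin of module 12 §2∕§3 (`N19LedgerPieces`, p475201) UNDER dag-n19-c g4's junction `N19FinestStepSpecies` (the lens rows s4′ × s4″ of
`ym-lens-BalabanUVNodes-decomp`'s `LENS-decomp.md` v3).  Filed `--kind proof --supports` K3′ `SpineGivenEndpointR12` = stmt-QuantumFields-19908 `--as helper`.
COUNT-NEUTRAL.  THEOREMS ONLY; no Theses import; edits nothing (`N19LedgerPieces`, `N19FinestStepSpecies`, `N19OtherKindsSpecies`, `N19LedgerLinkSync`,
`N19AtSpineCarriers` stay as filed).

WHY.  Module 12 split the N19 frame `N19LedgerLinkSync.LedgerAtSync` (37 fields) into six pieces F1 `TwoRunFormat` · F2 `LedgerBooking` · F3 `LedgerOtherKinds` ·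
F3′ `FinestStepModConst` · S `LedgerSize` · C `LedgerConventions` (`ledgerAtSync_iff_pieces`) and displayed F3′ — «the finest step matches a constant modulo
summable» — as THE FRAME's ONE ESTIMATE, «to be routed by NODE O».  dag-n19-c g4 then proved (`N19OtherKindsSpecies.otherClause_of_species`, p476356;
junction `N19FinestStepSpecies.finestStepModConst_of_species(_windowSum)`) that F3′ FOLLOWS BY NAME whenever the ledger data's remaining kinds are the SPECIES
forms `L.oA″ = exp α`, `L.oB″ = exp(Φ + e)·exp β` (centre `e + (β − α)`, radius `vol·ρ`, profile `ρ`) from data carrying NO two-run estimate on road (ii):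
(α) run B's unmatched first step with the ONE-RUN profile bound `|Φ| ≤ vol·ρ K`, `Summable ρ` ([Balaban1988Convergent] Thm 2 (2.43)∕(2.45) at age `K+1`,
node N11's output BY NAME as a binder) and (γ) the large-field normalisation constants with a centre-deviation datum `(b₀, s)` ([Balaban1989LargeFieldII]
p. 380, priced by `N19ConstantsWindow` through `constDev_le_windowSum`).  THIS MODULE composes the two, so that the road-(ii) ask of a spine record is
displayed WITHOUT F3′ as a hypothesis:
* §1 `ledgerAtSync_of_pieces_species` — F1 · F2 · F3 · S · C + the species data ⇒ `LedgerAtSync` (module 12's `ledgerAtSync_of_pieces` ∘ the junction).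
* §2 `core_summable_of_ledgerPieces_species` — the N19 edge `∃ δ, Spine.NE7.Core l₀ vol T Bad A B δ ∧ Summable δ` from F1 · F2 · F3 · S · C, the species
  data, and the in-edge letters (N16 = `NE3Shape` + liaison `GaugeDominated`, N18 = `NE5`, N22 = `NE9 ∧ FadingMemory`, N17 through node U2's OUTPUT
  `InjectedRate`, the printed box, the bracket (T) `LipBackground` + `PolyLipGrowth`, both runs' couplings in the window); and
  `core_summable_of_ledgerPieces_species_windowSum` — the same with (γ)'s deviation READ OFF the recent-ledger window letters.
* §3 `s_N19_of_ledgerPiecesSpeciesReading` — `YMDAG.UVSplit.S_N19 SRec Inputs` from a per-bundle reading handing F1 · F2 · F3 · S · C + species data +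
  in-edge letters under the `deltaOfRecord` pin of record (module 12's `s_N19_of_ledgerPiecesReading` with the F3′ conjunct REPLACED by the species
  conjuncts).  `SRec`, `Inputs` are PARAMETERS: the statement instantiates verbatim at the regime-restricted Stage-12 homes `SRec₁₂On cr Rg` ∕ `RRec₁₂On 𝔯 Rg`.

WHAT THIS DISPLAYS (lens «decomp» v3 verdict, as a kernel statement at the pieces of record).  On road (ii) the ledger pieces a spine record must hand for
N19 contain NO unprinted ESTIMATE: F1 is an unprinted two-run REPRESENTATION (common fluctuation measure ∕ variable space ∕ (2.25)-ledger; object-bound,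
NODE O — NE7 desk W-NE7-3), F2 ∕ F3 ∕ C are bookings and letters (node U5b's `FactorLogRatio` inside F3 is that node's output), S is the printed-grade
one-run size in the (2.43) profile, and F3′ is now one-run species data; everything two-run that is an ESTIMATE enters through the in-edge letters of
N16 ∕ N17 (U2) ∕ N18 ∕ N22 ∕ U5b and the bracket (T).  Which species NODE O's instance has, and the bookings B1–B3 of lens row NODE-O-BK, are NODE O's.
Road (i) (the same-tuple all-run-lengths rate edge; (V)+(I) source split ∕ species (β)) is NOT touched and its residual is unchanged (NOT PRINTED).

v1.1 (APPEND-ONLY; §1–§3 byte-identical; one import added).  §4 — species (γ) AT [Balaban1989LargeFieldII] p. 380's PRINTED FORM SHARES THE EDGE's OWN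
NODE-U2 LETTER.  dag-n19-c g4's `N19ConstantsSpeciesRate.otherClause_of_species_p380` (p478495) prices the constants' species from a per-operation split
`β − α = b₀ K + Σ_{ops} a·(log g_B − log g_A)` (`|a| ≤ A·w`, the `O(1)·|Z_j|` prefactor), a positive floor under both runs' couplings whose inverse grows
at most like `M·(K+1)` (the upper running), and node U2's coupling discrepancy `|g_B − g_A| ≤ Cd·(K+1)^c·θ′^j`.  §4 records (a) `abs_coupling_sub_le_of_injectedRate`:
the N19 edge's in-edge letter `InjectedRate Cd 0 θc (fun K j => disc (g K) (g (K+1)) j)` (U2's discrepancy in the printed variable `x = 1∕g²`,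
`T4CouplingMatching.disc`) together with the printed box `0 < g ≤ γ` GIVES that coupling-variable discrepancy for run A's table `g K` against run B's
shifted table `j ↦ g (K+1) (j+1)` at constant `γ³·Cd` and rate `θc` (`T4CouplingMatching.abs_sub_le_of_inv_sq`); (b) `finestStepModConst_of_species_p380`:
the junction of `otherClause_of_species_p380` into F3′ (the analogue of `N19FinestStepSpecies.finestStepModConst_of_species_windowSum` at the printed
form); (c) `core_summable_of_ledgerPieces_species_p380`: the N19 edge on road (ii) with (γ) at the printed form, in which U2's letter `hinj` is consumed
TWICE (E-terms via `NE9`, constants via (a)), the window letters are the ledger's own `L.Cw ∕ L.Λg ∕ L.Cl` (`1 ≤ L.Λg` from C, `0 ≤ L.Cl` from F2), the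
rate bound `θc < 1` is READ OFF C (`max ω θc < L.θ′ < 1`), and the only letters beyond §2's are ONE-RUN: the operations' booking (`ops ⊆ AllO`, weights,
`Multiplicity`, `RecentOnly`), the p. 380 prefactor `Ap`, the coupling floor `m` with its upper-running growth `Mr`, the split, and `0 < θc`.  So on road
(ii) species (γ) costs NO two-run letter beyond node U2's, which the edge already carries.

HONEST FRAMING.  Kernel bookkeeping: each theorem is ONE application of module 12 (p475201) composed with ONE application of the junction
(`N19FinestStepSpecies`); every species datum, every ledger piece and every in-edge letter is a HYPOTHESIS; nothing of Bałaban's is asserted beyond the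
locators quoted; NE7 ∕ NE7b ∕ NE7c NOT PRINTED for d = 4 and NOT PROVED; [III] Thm 2 (2.43) NOT proved here; NO node is discharged; K3′ NOT claimed; counts
UNMOVED (typed 28∕28 · discharged 5∕27, A 5∕28); one finite four-torus programme at fixed `ε = L^{−K}` — NOT ℝ⁴, NOT infinite volume, NOT OS, NOT a mass
gap, NOT Clay.  0 `def`; 0 `sorry`; standard axioms; no decl below carries a cite tag.
-/

set_option autoImplicit false

noncomputable section

open Finset MeasureTheory
open scoped BigOperators

namespace Summit.QuantumFields.YangMills.BalabanUVNodes.N19LedgerPiecesRoadII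

open Literature.MathematicalPhysics.QuantumFieldTheory.Balaban1983to89
open T4OutputRate T4RecentScale T4GoodClassBudget T4CauchySum T4TowerRateComposition T4TowerRateDischarge
open T4EtaRateMin (Readings NE3Shape)
open T4RateLiaison (GaugeDominated)
open Summit.QuantumFields.BalabanUV.T4Continuum.Spine
open Summit.QuantumFields.YangMills.BalabanUVNodes.N19LedgerLinkSync (LedgerDataSync LedgerAtSync)
open Summit.QuantumFields.YangMills.BalabanUVNodes.N19LedgerPieces (TwoRunFormat LedgerBooking LedgerOtherKinds FinestStepModConst LedgerSize
  LedgerConventions ledgerAtSync_of_pieces core_summable_of_ledgerPieces)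
open Summit.QuantumFields.YangMills.BalabanUVNodes.N19FinestStepSpecies (finestStepModConst_of_species finestStepModConst_of_species_windowSum)
open Summit.QuantumFields.YangMills.BalabanUVNodes.N19AtSpineCarriers (deltaOfRecord s_N19_of_coreEdge)
open YMDAG.UVSplit (SpineCarriers SpineRecordPred InputsPred S_N19)

/-! ## §1 Reassembly: the five object-bound ∕ printed-grade pieces and the species data give back `LedgerAtSync` -/

section Reassembly

variable {C : Carriers} [DecidableEq C.Dom] {F : Type*} {ι X : Type} [MeasurableSpace ι] {σ : Type*} [DecidableEq σ]
  {L : LedgerDataSync C F ι σ} {l₀ vol : ℝ} {T : ℕ → Finset σ} {Bad : ℕ → ℝ → Finset σ} {A B : ℕ → ℝ → σ → ℝ}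
  {R : Readings ι X} {EA : Functional C C.BgA} {EB : Functional C C.BgB} {κ : ℝ} {g : ℕ → ℕ → ℝ}
  {uA : ℕ → ι → C.BgA} {uB : ℕ → ι → C.BgB} {ω θc θ₅ θ₃ : ℝ}
  {Φ : ℕ → ℝ → σ → ι → ℝ} {e ρ : ℕ → ℝ} {α β : ℕ → ℝ → σ → ℝ}

/-- **`LedgerAtSync` FROM F1 · F2 · F3 · S · C AND THE SPECIES DATA** — module 12's reassembly `ledgerAtSync_of_pieces` with the estimate piece F3′
`FinestStepModConst` SUPPLIED by `N19FinestStepSpecies.finestStepModConst_of_species`: the remaining kinds in species form (`L.oA″ = exp α`,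
`L.oB″ = exp(Φ + e)·exp β`, `L.cO″ = e + (β − α)`, `L.RO″ = vol·ρ`, `L.rO″ = ρ`), the ONE-RUN first-step profile bound `|Φ| ≤ vol·ρ K` on good classes with
`Summable ρ` ((2.43)∕(2.45) at age `K+1`, N11 by name), and the constants' centre-deviation datum `(b₀, s)`.  F3′ is no longer a hypothesis. [bookkeeping] -/
theorem ledgerAtSync_of_pieces_species (hF : TwoRunFormat L l₀ T Bad A B R EA EB g uA uB) (hB : LedgerBooking L l₀ vol T Bad κ)
    (hO : LedgerOtherKinds L l₀ vol T Bad R EA EB g) (hS : LedgerSize L l₀ vol T Bad R EA EB g uA uB) (hC : LedgerConventions L vol R ω θc θ₅ θ₃)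
    (hoA : ∀ K t τ v, L.oA'' K t τ v = Real.exp (α K t τ))
    (hoB : ∀ K t τ v, L.oB'' K t τ v = Real.exp (Φ K t τ v + e K) * Real.exp (β K t τ))
    (hcO : ∀ K t τ, L.cO'' K t τ = e K + (β K t τ - α K t τ)) (hRO : ∀ K t τ, L.RO'' K t τ = vol * ρ K) (hrO : L.rO'' = ρ)
    (hΦ : ∀ K t, |t| ≤ l₀ → ∀ τ ∈ T K \ Bad K t, ∀ v ∈ R.dom, |Φ K t τ v| ≤ vol * ρ K) (hρ : Summable ρ)
    (hdev : ∃ b₀ s : ℕ → ℝ, Summable s ∧ ∀ K t, |t| ≤ l₀ → ∀ τ ∈ T K \ Bad K t, |β K t τ - α K t τ - b₀ K| ≤ vol * s K) :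
    LedgerAtSync L l₀ vol T Bad A B R EA EB κ g uA uB ω θc θ₅ θ₃ :=
  ledgerAtSync_of_pieces hF hB hO (finestStepModConst_of_species hoA hoB hcO hRO hrO hΦ hρ hdev) hS hC

end Reassembly

/-! ## §2 The N19 edge from F1 · F2 · F3 · S · C, the species data, and the in-edge letters -/

section Edge

variable {C : Carriers} [DecidableEq C.Dom] {F : Type*} {ι X : Type} [MeasurableSpace ι] {σ : Type*} [DecidableEq σ]
  {L : LedgerDataSync C F ι σ} {l₀ vol : ℝ} {T : ℕ → Finset σ} {Bad : ℕ → ℝ → Finset σ} {A B : ℕ → ℝ → σ → ℝ}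
  {R : Readings ι X} {W : Set (ℕ → ℝ)} {EA : Functional C C.BgA} {EB : Functional C C.BgB}
  {κ θ₅ C₅ C₉ ω θc Cd γ C₃ θ₃ Pg : ℝ} {q : ℕ} {Λm : ℕ → ℕ → ℝ} {CU : (ℕ → ℝ) → ℕ → ℝ}
  {g : ℕ → ℕ → ℝ} {uA : ℕ → ι → C.BgA} {uB : ℕ → ι → C.BgB}
  {Φ : ℕ → ℝ → σ → ι → ℝ} {e ρ : ℕ → ℝ} {α β : ℕ → ℝ → σ → ℝ}

/-- **THE N19 EDGE ON ROAD (ii) WITH NO UNPRINTED ESTIMATE AMONG THE LEDGER PIECES**: F1 two-run format (representation) · F2 booking · F3 other kinds factored ·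
S size · C conventions, the SPECIES DATA in place of F3′ (species forms of the remaining kinds, the one-run profile bound `|Φ| ≤ vol·ρ K` with `Summable ρ`, the
constants' deviation datum), plus the in-edge letters — N16 = `NE3Shape` with the liaison `GaugeDominated`, N18 = `NE5`, N22 = `NE9 ∧ FadingMemory`, N17 through
node U2's OUTPUT `InjectedRate` on the printed box, the bracket (T) `LipBackground` + `PolyLipGrowth`, both runs' re-indexed couplings in the window — ⇒
`∃ δ, Spine.NE7.Core l₀ vol T Bad A B δ ∧ Summable δ`.  (= module 12's `core_summable_of_ledgerPieces` ∘ `finestStepModConst_of_species`.)  CONDITIONAL on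
every binder; NOT NE7. [bookkeeping] -/
theorem core_summable_of_ledgerPieces_species (hF : TwoRunFormat L l₀ T Bad A B R EA EB g uA uB) (hB : LedgerBooking L l₀ vol T Bad κ)
    (hO : LedgerOtherKinds L l₀ vol T Bad R EA EB g) (hS : LedgerSize L l₀ vol T Bad R EA EB g uA uB) (hC : LedgerConventions L vol R ω θc θ₅ θ₃)
    (hoA : ∀ K t τ v, L.oA'' K t τ v = Real.exp (α K t τ))
    (hoB : ∀ K t τ v, L.oB'' K t τ v = Real.exp (Φ K t τ v + e K) * Real.exp (β K t τ))
    (hcO : ∀ K t τ, L.cO'' K t τ = e K + (β K t τ - α K t τ)) (hRO : ∀ K t τ, L.RO'' K t τ = vol * ρ K) (hrO : L.rO'' = ρ)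
    (hΦ : ∀ K t, |t| ≤ l₀ → ∀ τ ∈ T K \ Bad K t, ∀ v ∈ R.dom, |Φ K t τ v| ≤ vol * ρ K) (hρ : Summable ρ)
    (hdev : ∃ b₀ s : ℕ → ℝ, Summable s ∧ ∀ K t, |t| ≤ l₀ → ∀ τ ∈ T K \ Bad K t, |β K t τ - α K t τ - b₀ K| ≤ vol * s K)
    (h16 : NE3Shape R C₃ θ₃) (hC₃ : 0 ≤ C₃) (hgd : GaugeDominated R uA uB)
    (h18 : NE5 EA EB W κ θ₅ C₅) (hθ₅ : 0 ≤ θ₅) (hC₅ : 0 ≤ C₅)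
    (h22 : NE9 EA W κ Λm ∧ T4OutputRate.FadingMemory C₉ ω Λm) (hω : 0 ≤ ω)
    (hinj : InjectedRate Cd 0 θc (fun K j => T4CouplingMatching.disc (g K) (g (K + 1)) j)) (hCd : 0 ≤ Cd)
    (hθc : 0 ≤ θc) (hbox : ∀ K i, i ≤ K → 0 < g K i ∧ g K i ≤ γ)
    (hU : LipBackground EA W κ CU) (hG : PolyLipGrowth CU g Pg q) (hPg : 0 ≤ Pg)
    (hgA : ∀ K, g K ∈ W) (hgB : ∀ K, (fun i => g (K + 1) (i + 1)) ∈ W) :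
    ∃ δ : ℕ → ℝ, NE7.Core l₀ vol T Bad A B δ ∧ Summable δ :=
  core_summable_of_ledgerPieces hF hB hO (finestStepModConst_of_species hoA hoB hcO hRO hrO hΦ hρ hdev) hS hC h16 hC₃ hgd h18 hθ₅ hC₅ h22 hω
    hinj hCd hθc hbox hU hG hPg hgA hgB

/-- **THE N19 EDGE ON ROAD (ii), THE CONSTANTS' DEVIATION READ OFF THE WINDOW LETTERS** — `core_summable_of_ledgerPieces_species` with species (γ)'s deviation
datum PRODUCED from the recent-ledger letters (junction `finestStepModConst_of_species_windowSum` ∘ `N19OtherKindsSpecies.constDev_le_windowSum`): the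
operations `ops K t τ ⊆ AllO K` booked on the good term, weights `wO ≥ 0` on `AllO K`, full-torus `Multiplicity (AllO K) scO wO Cw vol Λ K`, `RecentOnly` down
to `jlogOf Cl K`, per-operation constant log-ratios `|cn K t τ i| ≤ Cn·θ′^{scO i}·wO i` ([Balaban1989LargeFieldII] p. 380's form after the log-Lipschitz step and
rate worsening), `0 ≤ Cn`, `0 < θ′ < 1`, `1 ≤ Λ`, `0 ≤ Cl`, and the split `β − α = b₀ K + Σ_{i ∈ ops K t τ} cn K t τ i`.  CONDITIONAL on every binder; NOT NE7.
[bookkeeping] -/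
theorem core_summable_of_ledgerPieces_species_windowSum {F' : Type*} {ops : ℕ → ℝ → σ → Finset F'} {AllO : ℕ → Finset F'} {scO : F' → ℕ}
    {wO : F' → ℝ} {cn : ℕ → ℝ → σ → F' → ℝ} {Cn θ' Cw Λ Cl : ℝ} {b₀ : ℕ → ℝ}
    (hF : TwoRunFormat L l₀ T Bad A B R EA EB g uA uB) (hB : LedgerBooking L l₀ vol T Bad κ)
    (hO : LedgerOtherKinds L l₀ vol T Bad R EA EB g) (hS : LedgerSize L l₀ vol T Bad R EA EB g uA uB) (hC : LedgerConventions L vol R ω θc θ₅ θ₃)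
    (hoA : ∀ K t τ v, L.oA'' K t τ v = Real.exp (α K t τ))
    (hoB : ∀ K t τ v, L.oB'' K t τ v = Real.exp (Φ K t τ v + e K) * Real.exp (β K t τ))
    (hcO : ∀ K t τ, L.cO'' K t τ = e K + (β K t τ - α K t τ)) (hRO : ∀ K t τ, L.RO'' K t τ = vol * ρ K) (hrO : L.rO'' = ρ)
    (hΦ : ∀ K t, |t| ≤ l₀ → ∀ τ ∈ T K \ Bad K t, ∀ v ∈ R.dom, |Φ K t τ v| ≤ vol * ρ K) (hρ : Summable ρ)
    (hsub : ∀ K t, |t| ≤ l₀ → ∀ τ ∈ T K \ Bad K t, ops K t τ ⊆ AllO K) (hw : ∀ K, ∀ i ∈ AllO K, 0 ≤ wO i)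
    (hM : ∀ K, Multiplicity (AllO K) scO wO Cw vol Λ K)
    (hrec : ∀ K t, |t| ≤ l₀ → ∀ τ ∈ T K \ Bad K t, RecentOnly (ops K t τ) scO (jlogOf Cl K) K)
    (hcn : ∀ K t, |t| ≤ l₀ → ∀ τ ∈ T K \ Bad K t, ∀ i ∈ ops K t τ, |cn K t τ i| ≤ Cn * θ' ^ scO i * wO i)
    (hCn : 0 ≤ Cn) (hθ0 : 0 < θ') (hθ1 : θ' < 1) (hΛ : 1 ≤ Λ) (hCl : 0 ≤ Cl)
    (hsplit : ∀ K t, |t| ≤ l₀ → ∀ τ ∈ T K \ Bad K t, β K t τ - α K t τ = b₀ K + ∑ i ∈ ops K t τ, cn K t τ i)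
    (h16 : NE3Shape R C₃ θ₃) (hC₃ : 0 ≤ C₃) (hgd : GaugeDominated R uA uB)
    (h18 : NE5 EA EB W κ θ₅ C₅) (hθ₅ : 0 ≤ θ₅) (hC₅ : 0 ≤ C₅)
    (h22 : NE9 EA W κ Λm ∧ T4OutputRate.FadingMemory C₉ ω Λm) (hω : 0 ≤ ω)
    (hinj : InjectedRate Cd 0 θc (fun K j => T4CouplingMatching.disc (g K) (g (K + 1)) j)) (hCd : 0 ≤ Cd)
    (hθc : 0 ≤ θc) (hbox : ∀ K i, i ≤ K → 0 < g K i ∧ g K i ≤ γ)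
    (hU : LipBackground EA W κ CU) (hG : PolyLipGrowth CU g Pg q) (hPg : 0 ≤ Pg)
    (hgA : ∀ K, g K ∈ W) (hgB : ∀ K, (fun i => g (K + 1) (i + 1)) ∈ W) :
    ∃ δ : ℕ → ℝ, NE7.Core l₀ vol T Bad A B δ ∧ Summable δ :=
  core_summable_of_ledgerPieces hF hB hO
    (finestStepModConst_of_species_windowSum hoA hoB hcO hRO hrO hΦ hρ hsub hw hM hrec hcn hCn hθ0 hθ1 hΛ hCl hsplit) hS hC h16 hC₃ hgd
    h18 hθ₅ hC₅ h22 hω hinj hCd hθc hbox hU hG hPg hgA hgB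

end Edge

/-! ## §3 The reading at the spine carriers: `S_N19` from a per-bundle ledger reading with the species data in place of F3′ -/

section Reading

variable {N : ℕ} [NeZero N]

/-- **`S_N19` FROM A LEDGER READING WITH NO UNPRINTED ESTIMATE AMONG THE PIECES** (module 12's `s_N19_of_ledgerPiecesReading` with the F3′ conjunct
`FinestStepModConst` REPLACED by the species conjuncts; under the `deltaOfRecord` pin of record): if the carriers of record and K4's inputs hand, for every
bundle, ledger data `L`, readings `R` and letters such that F1 · F2 · F3 · S · C hold, the remaining kinds are in SPECIES FORM with the ONE-RUN first-step
profile bound `|Φ| ≤ S.vol·ρ K` (`Summable ρ`; (2.43)∕(2.45) at age `K+1`, N11 by name) and a constants' deviation datum `(b₀, s)`, together with the in-edge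
letters (N16 ∕ N17 via U2 ∕ N18 ∕ N22, the box, the bracket (T), the window), then `YMDAG.UVSplit.S_N19 SRec Inputs`.  `SRec`, `Inputs` PARAMETERS (verbatim
at `SRec₁₂On cr Rg` ∕ `RRec₁₂On 𝔯 Rg`); every conjunct a HYPOTHESIS; NOT NE7. [bookkeeping] -/
theorem s_N19_of_ledgerPiecesSpeciesReading (SRec : SpineRecordPred N) (Inputs : InputsPred N)
    (hpin : ∀ (F : T4Continuum.T4Family) (D : YMDAG.UVSplit.Datum F N) (g₀ : ℕ → ℝ) (os : List (T4Continuum.ULoop F))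
      (S : SpineCarriers), SRec F D g₀ os S → letI := S.dec
      S.δ = deltaOfRecord S.l₀ S.vol S.T S.Bad (fun K t τ => S.A K t τ - S.shA K t τ) (fun K t τ => S.B K t τ - S.shB K t τ))
    (hread : ∀ (F : T4Continuum.T4Family) (D : YMDAG.UVSplit.Datum F N) (g₀ : ℕ → ℝ) (os : List (T4Continuum.ULoop F))
      (S : SpineCarriers), SRec F D g₀ os S → Inputs F D g₀ os → letI := S.dec
      ∃ (C : Carriers) (_ : DecidableEq C.Dom) (F' : Type) (ι' X' : Type) (_ : MeasurableSpace ι')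
        (L : LedgerDataSync C F' ι' S.ι) (R : Readings ι' X') (W : Set (ℕ → ℝ)) (EA : Functional C C.BgA)
        (EB : Functional C C.BgB) (κ θ₅ C₅ C₉ ω θc Cd γ C₃ θ₃ Pg : ℝ) (q : ℕ) (Λm : ℕ → ℕ → ℝ)
        (CU : (ℕ → ℝ) → ℕ → ℝ) (g : ℕ → ℕ → ℝ) (uA : ℕ → ι' → C.BgA) (uB : ℕ → ι' → C.BgB)
        (Φ : ℕ → ℝ → S.ι → ι' → ℝ) (e ρ : ℕ → ℝ) (α β : ℕ → ℝ → S.ι → ℝ),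
        (TwoRunFormat L S.l₀ S.T S.Bad (fun K t τ => S.A K t τ - S.shA K t τ) (fun K t τ => S.B K t τ - S.shB K t τ) R EA EB g uA uB ∧
          LedgerBooking L S.l₀ S.vol S.T S.Bad κ ∧ LedgerOtherKinds L S.l₀ S.vol S.T S.Bad R EA EB g ∧
          LedgerSize L S.l₀ S.vol S.T S.Bad R EA EB g uA uB ∧ LedgerConventions L S.vol R ω θc θ₅ θ₃) ∧
        ((∀ K t τ v, L.oA'' K t τ v = Real.exp (α K t τ)) ∧
          (∀ K t τ v, L.oB'' K t τ v = Real.exp (Φ K t τ v + e K) * Real.exp (β K t τ)) ∧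
          (∀ K t τ, L.cO'' K t τ = e K + (β K t τ - α K t τ)) ∧ (∀ K t τ, L.RO'' K t τ = S.vol * ρ K) ∧ L.rO'' = ρ ∧
          (∀ K t, |t| ≤ S.l₀ → ∀ τ ∈ S.T K \ S.Bad K t, ∀ v ∈ R.dom, |Φ K t τ v| ≤ S.vol * ρ K) ∧ Summable ρ ∧
          (∃ b₀ s : ℕ → ℝ, Summable s ∧ ∀ K t, |t| ≤ S.l₀ → ∀ τ ∈ S.T K \ S.Bad K t, |β K t τ - α K t τ - b₀ K| ≤ S.vol * s K)) ∧
        NE3Shape R C₃ θ₃ ∧ 0 ≤ C₃ ∧ GaugeDominated R uA uB ∧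
        NE5 EA EB W κ θ₅ C₅ ∧ 0 ≤ θ₅ ∧ 0 ≤ C₅ ∧
        (NE9 EA W κ Λm ∧ T4OutputRate.FadingMemory C₉ ω Λm) ∧ 0 ≤ ω ∧
        InjectedRate Cd 0 θc (fun K j => T4CouplingMatching.disc (g K) (g (K + 1)) j) ∧ 0 ≤ Cd ∧ 0 ≤ θc ∧
        (∀ K i, i ≤ K → 0 < g K i ∧ g K i ≤ γ) ∧
        LipBackground EA W κ CU ∧ PolyLipGrowth CU g Pg q ∧ 0 ≤ Pg ∧
        (∀ K, g K ∈ W) ∧ (∀ K, (fun i => g (K + 1) (i + 1)) ∈ W)) :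
    S_N19 SRec Inputs := by
  refine s_N19_of_coreEdge SRec Inputs hpin fun F D g₀ os S hS hI => ?_
  letI := S.dec
  obtain ⟨C, _, F', ι', X', _, L, R, W, EA, EB, κ, θ₅, C₅, C₉, ω, θc, Cd, γ, C₃, θ₃, Pg, q, Λm, CU, g, uA, uB, Φ, e, ρ, α, β,
    ⟨hF, hB, hO, hSz, hC⟩, ⟨hoA, hoB, hcO, hRO, hrO, hΦ, hρ, hdev⟩,
    h16, hC₃, hgd, h18, hθ₅, hC₅, h22, hω, hinj, hCd, hθc, hbox, hU, hG, hPg, hgA, hgB⟩ := hread F D g₀ os S hS hI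
  exact core_summable_of_ledgerPieces_species hF hB hO hSz hC hoA hoB hcO hRO hrO hΦ hρ hdev h16 hC₃ hgd h18 hθ₅ hC₅ h22 hω hinj hCd hθc
    hbox hU hG hPg hgA hgB

end Reading

/-! ## §4 (v1.1) Species (γ) at [B16] p. 380's printed form shares the edge's own node-U2 letter -/

section PrintedConstants

open Summit.QuantumFields.YangMills.BalabanUVNodes.N19ConstantsSpeciesRate (otherClause_of_species_p380)

variable {C : Carriers} [DecidableEq C.Dom] {F : Type*} {ι X : Type} [MeasurableSpace ι] {σ : Type*} [DecidableEq σ]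
  {L : LedgerDataSync C F ι σ} {l₀ vol : ℝ} {T : ℕ → Finset σ} {Bad : ℕ → ℝ → Finset σ} {A B : ℕ → ℝ → σ → ℝ}
  {R : Readings ι X} {W : Set (ℕ → ℝ)} {EA : Functional C C.BgA} {EB : Functional C C.BgB}
  {κ θ₅ C₅ C₉ ω θc Cd γ C₃ θ₃ Pg : ℝ} {q : ℕ} {Λm : ℕ → ℕ → ℝ} {CU : (ℕ → ℝ) → ℕ → ℝ}
  {g : ℕ → ℕ → ℝ} {uA : ℕ → ι → C.BgA} {uB : ℕ → ι → C.BgB}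
  {Φ : ℕ → ℝ → σ → ι → ℝ} {e ρ : ℕ → ℝ} {α β : ℕ → ℝ → σ → ℝ}

/-- **NODE U2's LETTER READ IN THE COUPLING VARIABLE** [folklore].  The N19 edge's in-edge letter `InjectedRate Cd 0 θc (fun K j => disc (g K) (g (K+1)) j)`
— node U2's discrepancy `|1∕(g^A_j)² − 1∕(g^B_{j+1})²| ≤ Cd·θc^j` (`j ≤ K`) in the printed recursion variable `x = 1∕g²` of [Balaban1987RG1] (0.20), run A's
table `g K` against run B's IR-matched table `j ↦ g (K+1) (j+1)` — together with the printed box `0 < g K i ≤ γ` (`i ≤ K`) bounds the COUPLING discrepancy: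
`|g (K+1) (j+1) − g K j| ≤ (γ³·Cd)·(K+1)⁰·θc^j` for `j ≤ K` (`T4CouplingMatching.abs_sub_le_of_inv_sq`: `|a − b| ≤ a²·b·|1∕a² − 1∕b²|`).  This is the `hdisc`
input of `N19ConstantsSpeciesRate.otherClause_of_species_p380` at `c = 0`. -/
theorem abs_coupling_sub_le_of_injectedRate (hinj : InjectedRate Cd 0 θc (fun K j => T4CouplingMatching.disc (g K) (g (K + 1)) j))
    (hbox : ∀ K i, i ≤ K → 0 < g K i ∧ g K i ≤ γ) :
    ∀ K j, j ≤ K → |g (K + 1) (j + 1) - g K j| ≤ γ ^ 3 * Cd * ((K : ℝ) + 1) ^ 0 * θc ^ j := by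
  intro K j hj
  obtain ⟨ha, haγ⟩ := hbox K j hj
  obtain ⟨hb, hbγ⟩ := hbox (K + 1) (j + 1) (Nat.succ_le_succ hj)
  obtain ⟨hd0, hd⟩ := hinj K j hj
  have hγ : 0 ≤ γ := ha.le.trans haγ
  have h1 : |g K j - g (K + 1) (j + 1)| ≤ g K j ^ 2 * g (K + 1) (j + 1) * T4CouplingMatching.disc (g K) (g (K + 1)) j := by
    unfold T4CouplingMatching.disc
    exact T4CouplingMatching.abs_sub_le_of_inv_sq ha hb
  have h2 : g K j ^ 2 * g (K + 1) (j + 1) ≤ γ ^ 3 :=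
    calc g K j ^ 2 * g (K + 1) (j + 1) ≤ γ ^ 2 * γ := mul_le_mul (pow_le_pow_left₀ ha.le haγ 2) hbγ hb.le (pow_nonneg hγ 2)
      _ = γ ^ 3 := by ring
  rw [abs_sub_comm]
  calc |g K j - g (K + 1) (j + 1)| ≤ g K j ^ 2 * g (K + 1) (j + 1) * T4CouplingMatching.disc (g K) (g (K + 1)) j := h1
    _ ≤ γ ^ 3 * (Cd * ((K : ℝ) + 1) ^ 0 * θc ^ j) := mul_le_mul h2 hd hd0 (pow_nonneg hγ 3)
    _ = γ ^ 3 * Cd * ((K : ℝ) + 1) ^ 0 * θc ^ j := by ring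

omit [DecidableEq C.Dom] in
/-- **THE FRAME's ESTIMATE PIECE F3′ FROM THE SPECIES DATA, (γ) AT THE PRINTED FORM** [bookkeeping] — the junction of dag-n19-c's
`N19ConstantsSpeciesRate.otherClause_of_species_p380` into `N19LedgerPieces.FinestStepModConst` (the printed-form analogue of
`N19FinestStepSpecies.finestStepModConst_of_species_windowSum`): species forms of the remaining kinds (`L.oA″ = exp α`, `L.oB″ = exp(Φ + e)·exp β`,
`L.cO″ = e + (β − α)`, `L.RO″ = vol·ρ`, `L.rO″ = ρ`), the ONE-RUN first-step bound `|Φ| ≤ vol·ρ K` with `Summable ρ`, and for (γ): operations `ops K t τ ⊆ AllO K`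
with weights `wO ≥ 0`, `Multiplicity (AllO K) scO wO Cw vol Λ K`, `RecentOnly` down to `jlogOf Cl K`, the split `β − α = b₀ K + Σ_{ops} a·(log g_B − log g_A)` at the
operations' scales, prefactors `|a| ≤ Ap·wO`, a floor `0 < m K j ≤ g_A K j, g_B K j` with `(m K j)⁻¹ ≤ Mr·(K+1)` (`j ≤ K`), and the coupling discrepancy
`|g_B K j − g_A K j| ≤ Cδ·(K+1)^c·θδ^j` (`0 < θδ < 1`, `1 ≤ Λ`, `0 ≤ Cl`) ⇒ `FinestStepModConst L l₀ vol T Bad R`.  One application; nothing two-run beyond the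
coupling discrepancy. -/
theorem finestStepModConst_of_species_p380 {F' : Type*} {ops : ℕ → ℝ → σ → Finset F'} {AllO : ℕ → Finset F'} {scO : F' → ℕ}
    {wO : F' → ℝ} {a : ℕ → ℝ → σ → F' → ℝ} {gA gB m : ℕ → ℕ → ℝ} {Ap Mr Cδ θδ Cw Λ Cl : ℝ} {c : ℕ} {b₀ : ℕ → ℝ}
    (hoA : ∀ K t τ v, L.oA'' K t τ v = Real.exp (α K t τ))
    (hoB : ∀ K t τ v, L.oB'' K t τ v = Real.exp (Φ K t τ v + e K) * Real.exp (β K t τ))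
    (hcO : ∀ K t τ, L.cO'' K t τ = e K + (β K t τ - α K t τ)) (hRO : ∀ K t τ, L.RO'' K t τ = vol * ρ K) (hrO : L.rO'' = ρ)
    (hΦ : ∀ K t, |t| ≤ l₀ → ∀ τ ∈ T K \ Bad K t, ∀ v ∈ R.dom, |Φ K t τ v| ≤ vol * ρ K) (hρ : Summable ρ)
    (hsub : ∀ K t, |t| ≤ l₀ → ∀ τ ∈ T K \ Bad K t, ops K t τ ⊆ AllO K) (hw : ∀ K, ∀ i ∈ AllO K, 0 ≤ wO i)
    (hMu : ∀ K, Multiplicity (AllO K) scO wO Cw vol Λ K)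
    (hrec : ∀ K t, |t| ≤ l₀ → ∀ τ ∈ T K \ Bad K t, RecentOnly (ops K t τ) scO (jlogOf Cl K) K)
    (hsplit : ∀ K t, |t| ≤ l₀ → ∀ τ ∈ T K \ Bad K t,
      β K t τ - α K t τ = b₀ K + ∑ i ∈ ops K t τ, a K t τ i * (Real.log (gB K (scO i)) - Real.log (gA K (scO i))))
    (ha : ∀ K t, |t| ≤ l₀ → ∀ τ ∈ T K \ Bad K t, ∀ i ∈ ops K t τ, |a K t τ i| ≤ Ap * wO i) (hAp : 0 ≤ Ap)
    (hm : ∀ K j, j ≤ K → 0 < m K j) (hmA : ∀ K j, j ≤ K → m K j ≤ gA K j) (hmB : ∀ K j, j ≤ K → m K j ≤ gB K j)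
    (hMr : ∀ K j, j ≤ K → (m K j)⁻¹ ≤ Mr * ((K : ℝ) + 1))
    (hCδ : 0 ≤ Cδ) (hdisc : ∀ K j, j ≤ K → |gB K j - gA K j| ≤ Cδ * ((K : ℝ) + 1) ^ c * θδ ^ j)
    (hθ0 : 0 < θδ) (hθ1 : θδ < 1) (hΛ : 1 ≤ Λ) (hCl : 0 ≤ Cl) :
    FinestStepModConst L l₀ vol T Bad R := by
  obtain ⟨-, hoth, hRle, hsum, hcdev⟩ := otherClause_of_species_p380 (dom := R.dom) (l₀ := l₀) (T := T) (Bad := Bad)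
    hoA hoB hΦ hρ hsub hw hMu hrec hsplit ha hAp hm hmA hmB hMr hCδ hdisc hθ0 hθ1 hΛ hCl
  refine ⟨fun K t ht τ hτ v hv => ?_, fun K t ht τ hτ => ?_, hrO ▸ hsum, ?_⟩
  · rw [hcO, hRO]; exact hoth K t ht τ hτ v hv
  · rw [hRO, hrO]
  · obtain ⟨c₀, s, hs, h⟩ := hcdev
    exact ⟨c₀, s, hs, fun K t ht τ hτ => by rw [hcO]; exact h K t ht τ hτ⟩

/-- **THE N19 EDGE ON ROAD (ii), (γ) AT THE PRINTED FORM, SHARING NODE U2's LETTER** [bookkeeping].  `core_summable_of_ledgerPieces_species` with species (γ)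
priced at [Balaban1989LargeFieldII] p. 380's form: the per-operation split `β − α = b₀ K + Σ_{i ∈ ops K t τ} a K t τ i·(log (g (K+1) (scO i + 1)) − log (g K (scO i)))`
over operations `ops K t τ ⊆ AllO K` booked on the LEDGER's OWN window letters (`Multiplicity (AllO K) scO wO L.Cw vol L.Λg K`, `RecentOnly … (jlogOf L.Cl K) K` —
`1 ≤ L.Λg` from C, `0 ≤ L.Cl` from F2), prefactors `|a| ≤ Ap·wO` (`0 ≤ Ap`), a ONE-RUN coupling floor `0 < m K j ≤ g K j, g (K+1) (j+1)` with upper-running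
growth `(m K j)⁻¹ ≤ Mr·(K+1)` (`j ≤ K`), and `0 < θc`.  The coupling discrepancy is NOT a new letter: it is the edge's own `hinj : InjectedRate Cd 0 θc disc`
read in the coupling variable through `abs_coupling_sub_le_of_injectedRate` and the box; `θc < 1` is read off C (`max ω θc < L.θ′ < 1`).  Conclusion:
`∃ δ, Spine.NE7.Core l₀ vol T Bad A B δ ∧ Summable δ`.  CONDITIONAL on every binder; NOT NE7; on road (ii) species (γ) costs no two-run letter beyond U2's. -/
theorem core_summable_of_ledgerPieces_species_p380 {F' : Type*} {ops : ℕ → ℝ → σ → Finset F'} {AllO : ℕ → Finset F'} {scO : F' → ℕ}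
    {wO : F' → ℝ} {a : ℕ → ℝ → σ → F' → ℝ} {m : ℕ → ℕ → ℝ} {Ap Mr : ℝ} {b₀ : ℕ → ℝ}
    (hF : TwoRunFormat L l₀ T Bad A B R EA EB g uA uB) (hB : LedgerBooking L l₀ vol T Bad κ)
    (hO : LedgerOtherKinds L l₀ vol T Bad R EA EB g) (hS : LedgerSize L l₀ vol T Bad R EA EB g uA uB) (hC : LedgerConventions L vol R ω θc θ₅ θ₃)
    (hoA : ∀ K t τ v, L.oA'' K t τ v = Real.exp (α K t τ))
    (hoB : ∀ K t τ v, L.oB'' K t τ v = Real.exp (Φ K t τ v + e K) * Real.exp (β K t τ))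
    (hcO : ∀ K t τ, L.cO'' K t τ = e K + (β K t τ - α K t τ)) (hRO : ∀ K t τ, L.RO'' K t τ = vol * ρ K) (hrO : L.rO'' = ρ)
    (hΦ : ∀ K t, |t| ≤ l₀ → ∀ τ ∈ T K \ Bad K t, ∀ v ∈ R.dom, |Φ K t τ v| ≤ vol * ρ K) (hρ : Summable ρ)
    (hsub : ∀ K t, |t| ≤ l₀ → ∀ τ ∈ T K \ Bad K t, ops K t τ ⊆ AllO K) (hw : ∀ K, ∀ i ∈ AllO K, 0 ≤ wO i)
    (hMu : ∀ K, Multiplicity (AllO K) scO wO L.Cw vol L.Λg K)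
    (hrec : ∀ K t, |t| ≤ l₀ → ∀ τ ∈ T K \ Bad K t, RecentOnly (ops K t τ) scO (jlogOf L.Cl K) K)
    (hsplit : ∀ K t, |t| ≤ l₀ → ∀ τ ∈ T K \ Bad K t,
      β K t τ - α K t τ = b₀ K + ∑ i ∈ ops K t τ, a K t τ i * (Real.log (g (K + 1) (scO i + 1)) - Real.log (g K (scO i))))
    (ha : ∀ K t, |t| ≤ l₀ → ∀ τ ∈ T K \ Bad K t, ∀ i ∈ ops K t τ, |a K t τ i| ≤ Ap * wO i) (hAp : 0 ≤ Ap)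
    (hm : ∀ K j, j ≤ K → 0 < m K j) (hmA : ∀ K j, j ≤ K → m K j ≤ g K j) (hmB : ∀ K j, j ≤ K → m K j ≤ g (K + 1) (j + 1))
    (hMr : ∀ K j, j ≤ K → (m K j)⁻¹ ≤ Mr * ((K : ℝ) + 1)) (hθc0 : 0 < θc)
    (h16 : NE3Shape R C₃ θ₃) (hC₃ : 0 ≤ C₃) (hgd : GaugeDominated R uA uB)
    (h18 : NE5 EA EB W κ θ₅ C₅) (hθ₅ : 0 ≤ θ₅) (hC₅ : 0 ≤ C₅)
    (h22 : NE9 EA W κ Λm ∧ T4OutputRate.FadingMemory C₉ ω Λm) (hω : 0 ≤ ω)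
    (hinj : InjectedRate Cd 0 θc (fun K j => T4CouplingMatching.disc (g K) (g (K + 1)) j)) (hCd : 0 ≤ Cd)
    (hbox : ∀ K i, i ≤ K → 0 < g K i ∧ g K i ≤ γ)
    (hU : LipBackground EA W κ CU) (hG : PolyLipGrowth CU g Pg q) (hPg : 0 ≤ Pg)
    (hgA : ∀ K, g K ∈ W) (hgB : ∀ K, (fun i => g (K + 1) (i + 1)) ∈ W) :
    ∃ δ : ℕ → ℝ, NE7.Core l₀ vol T Bad A B δ ∧ Summable δ := by
  have hγ : 0 ≤ γ := (hbox 0 0 le_rfl).1.le.trans (hbox 0 0 le_rfl).2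
  have hθc1 : θc < 1 := ((le_max_right ω θc).trans_lt hC.rate_gt).trans hC.rate_lt_one
  exact core_summable_of_ledgerPieces hF hB hO
    (finestStepModConst_of_species_p380 (gA := g) (gB := fun K j => g (K + 1) (j + 1)) hoA hoB hcO hRO hrO hΦ hρ hsub hw hMu hrec
      hsplit ha hAp hm hmA hmB hMr (mul_nonneg (pow_nonneg hγ 3) hCd) (abs_coupling_sub_le_of_injectedRate hinj hbox) hθc0 hθc1
      hC.one_le_base hB.Cl_nonneg)
    hS hC h16 hC₃ hgd h18 hθ₅ hC₅ h22 hω hinj hCd hθc0.le hbox hU hG hPg hgA hgB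

end PrintedConstants

section PrintedConstantsReading

variable {N : ℕ} [NeZero N]

/-- **`S_N19` FROM A LEDGER READING WITH (γ) AT THE PRINTED FORM** (§3's `s_N19_of_ledgerPiecesSpeciesReading` with the constants' deviation datum `(b₀, s)`
REPLACED by the p. 380 letters of `core_summable_of_ledgerPieces_species_p380`; under the `deltaOfRecord` pin of record): per bundle the carriers of record and
K4's inputs hand ledger data `L`, readings `R` and letters with F1 · F2 · F3 · S · C, the remaining kinds in SPECIES FORM with the ONE-RUN first-step bound, the
operations' booking on the ledger's own window letters (`ops ⊆ AllO`, `wO ≥ 0`, `Multiplicity (AllO K) scO wO L.Cw S.vol L.Λg K`, `RecentOnly … (jlogOf L.Cl K) K`),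
the split of `β − α` over the operations with prefactors `|a| ≤ Ap·wO`, a coupling floor `m` under both tables with upper-running growth `Mr`, `0 < θc`, and the
in-edge letters (U2's `InjectedRate` feeding BOTH the E-terms and the constants) ⇒ `YMDAG.UVSplit.S_N19 SRec Inputs`.  `SRec`, `Inputs` PARAMETERS; every
conjunct a HYPOTHESIS; NOT NE7. [bookkeeping] -/
theorem s_N19_of_ledgerPiecesSpeciesP380Reading (SRec : SpineRecordPred N) (Inputs : InputsPred N)
    (hpin : ∀ (F : T4Continuum.T4Family) (D : YMDAG.UVSplit.Datum F N) (g₀ : ℕ → ℝ) (os : List (T4Continuum.ULoop F))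
      (S : SpineCarriers), SRec F D g₀ os S → letI := S.dec
      S.δ = deltaOfRecord S.l₀ S.vol S.T S.Bad (fun K t τ => S.A K t τ - S.shA K t τ) (fun K t τ => S.B K t τ - S.shB K t τ))
    (hread : ∀ (F : T4Continuum.T4Family) (D : YMDAG.UVSplit.Datum F N) (g₀ : ℕ → ℝ) (os : List (T4Continuum.ULoop F))
      (S : SpineCarriers), SRec F D g₀ os S → Inputs F D g₀ os → letI := S.dec
      ∃ (C : Carriers) (_ : DecidableEq C.Dom) (F' : Type) (ι' X' : Type) (_ : MeasurableSpace ι')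
        (L : LedgerDataSync C F' ι' S.ι) (R : Readings ι' X') (W : Set (ℕ → ℝ)) (EA : Functional C C.BgA)
        (EB : Functional C C.BgB) (κ θ₅ C₅ C₉ ω θc Cd γ C₃ θ₃ Pg : ℝ) (q : ℕ) (Λm : ℕ → ℕ → ℝ)
        (CU : (ℕ → ℝ) → ℕ → ℝ) (g : ℕ → ℕ → ℝ) (uA : ℕ → ι' → C.BgA) (uB : ℕ → ι' → C.BgB)
        (Φ : ℕ → ℝ → S.ι → ι' → ℝ) (e ρ : ℕ → ℝ) (α β : ℕ → ℝ → S.ι → ℝ)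
        (O : Type) (ops : ℕ → ℝ → S.ι → Finset O) (AllO : ℕ → Finset O) (scO : O → ℕ) (wO : O → ℝ) (a : ℕ → ℝ → S.ι → O → ℝ)
        (m : ℕ → ℕ → ℝ) (Ap Mr : ℝ) (b₀ : ℕ → ℝ),
        (TwoRunFormat L S.l₀ S.T S.Bad (fun K t τ => S.A K t τ - S.shA K t τ) (fun K t τ => S.B K t τ - S.shB K t τ) R EA EB g uA uB ∧
          LedgerBooking L S.l₀ S.vol S.T S.Bad κ ∧ LedgerOtherKinds L S.l₀ S.vol S.T S.Bad R EA EB g ∧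
          LedgerSize L S.l₀ S.vol S.T S.Bad R EA EB g uA uB ∧ LedgerConventions L S.vol R ω θc θ₅ θ₃) ∧
        ((∀ K t τ v, L.oA'' K t τ v = Real.exp (α K t τ)) ∧
          (∀ K t τ v, L.oB'' K t τ v = Real.exp (Φ K t τ v + e K) * Real.exp (β K t τ)) ∧
          (∀ K t τ, L.cO'' K t τ = e K + (β K t τ - α K t τ)) ∧ (∀ K t τ, L.RO'' K t τ = S.vol * ρ K) ∧ L.rO'' = ρ ∧
          (∀ K t, |t| ≤ S.l₀ → ∀ τ ∈ S.T K \ S.Bad K t, ∀ v ∈ R.dom, |Φ K t τ v| ≤ S.vol * ρ K) ∧ Summable ρ) ∧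
        ((∀ K t, |t| ≤ S.l₀ → ∀ τ ∈ S.T K \ S.Bad K t, ops K t τ ⊆ AllO K) ∧ (∀ K, ∀ i ∈ AllO K, 0 ≤ wO i) ∧
          (∀ K, Multiplicity (AllO K) scO wO L.Cw S.vol L.Λg K) ∧
          (∀ K t, |t| ≤ S.l₀ → ∀ τ ∈ S.T K \ S.Bad K t, RecentOnly (ops K t τ) scO (jlogOf L.Cl K) K) ∧
          (∀ K t, |t| ≤ S.l₀ → ∀ τ ∈ S.T K \ S.Bad K t,
            β K t τ - α K t τ = b₀ K + ∑ i ∈ ops K t τ, a K t τ i * (Real.log (g (K + 1) (scO i + 1)) - Real.log (g K (scO i)))) ∧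
          (∀ K t, |t| ≤ S.l₀ → ∀ τ ∈ S.T K \ S.Bad K t, ∀ i ∈ ops K t τ, |a K t τ i| ≤ Ap * wO i) ∧ 0 ≤ Ap ∧
          (∀ K j, j ≤ K → 0 < m K j) ∧ (∀ K j, j ≤ K → m K j ≤ g K j) ∧ (∀ K j, j ≤ K → m K j ≤ g (K + 1) (j + 1)) ∧
          (∀ K j, j ≤ K → (m K j)⁻¹ ≤ Mr * ((K : ℝ) + 1)) ∧ 0 < θc) ∧
        NE3Shape R C₃ θ₃ ∧ 0 ≤ C₃ ∧ GaugeDominated R uA uB ∧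
        NE5 EA EB W κ θ₅ C₅ ∧ 0 ≤ θ₅ ∧ 0 ≤ C₅ ∧
        (NE9 EA W κ Λm ∧ T4OutputRate.FadingMemory C₉ ω Λm) ∧ 0 ≤ ω ∧
        InjectedRate Cd 0 θc (fun K j => T4CouplingMatching.disc (g K) (g (K + 1)) j) ∧ 0 ≤ Cd ∧
        (∀ K i, i ≤ K → 0 < g K i ∧ g K i ≤ γ) ∧
        LipBackground EA W κ CU ∧ PolyLipGrowth CU g Pg q ∧ 0 ≤ Pg ∧
        (∀ K, g K ∈ W) ∧ (∀ K, (fun i => g (K + 1) (i + 1)) ∈ W)) :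
    S_N19 SRec Inputs := by
  refine s_N19_of_coreEdge SRec Inputs hpin fun F D g₀ os S hS hI => ?_
  letI := S.dec
  obtain ⟨C, _, F', ι', X', _, L, R, W, EA, EB, κ, θ₅, C₅, C₉, ω, θc, Cd, γ, C₃, θ₃, Pg, q, Λm, CU, g, uA, uB, Φ, e, ρ, α, β,
    O, ops, AllO, scO, wO, a, m, Ap, Mr, b₀,
    ⟨hF, hB, hO, hSz, hC⟩, ⟨hoA, hoB, hcO, hRO, hrO, hΦ, hρ⟩,
    ⟨hsub, hw, hMu, hrec, hsplit, ha, hAp, hm, hmA, hmB, hMr, hθc0⟩,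
    h16, hC₃, hgd, h18, hθ₅, hC₅, h22, hω, hinj, hCd, hbox, hU, hG, hPg, hgA, hgB⟩ := hread F D g₀ os S hS hI
  exact core_summable_of_ledgerPieces_species_p380 hF hB hO hSz hC hoA hoB hcO hRO hrO hΦ hρ hsub hw hMu hrec hsplit ha hAp hm hmA hmB hMr
    hθc0 h16 hC₃ hgd h18 hθ₅ hC₅ h22 hω hinj hCd hbox hU hG hPg hgA hgB

end PrintedConstantsReading

end Summit.QuantumFields.YangMills.BalabanUVNodes.N19LedgerPiecesRoadII

end
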